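import Mathlib
import Summits.NavierStokesRegularity.NavierStokesRegularity.Theorems.FilamentSkeletonRssStadiumBaseMargin
import Summits.NavierStokesRegularity.NavierStokesRegularity.Theorems.FilamentSkeletonRssStadiumMarginKernel
import Summits.NavierStokesRegularity.NavierStokesRegularity.Theorems.FilamentSkeletonRssStadiumFixedSourcePiece

/-!
# The frozen CONNECTOR piece is `O(length)` (`TangentSkeletonNearStraightL`, stmt-NavierStokesRegularity-23320, registered stub `stub_stripPropagation` —
# blueprint item R6′, connectors)

Same setting as Theorems.StadiumConnectorPiece (connector `x₀ + it`, `t ∈ [a,b]`, at horizontal distance `≥ r₀` from the ball of targets, height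
differences `≤ m r₀`): the sloped-pair margin `m₀ = r₀²·C` and the constant majorant `m₀^{−3/2}·2M²R₁` (`R₁ = δ + |Re z₀ − x₀| + |Im z₀ − a| + |Im z₀ − b|`)
give `‖∫_{[a,b]} K(z, x₀ + i·clamp t) dt‖ ≤ (b − a)·m₀^{−3/2}·2M²R₁` for every target `z` of the ball (`connector_norm_le`).  In the retype `b − a ≤ h`,
`r₀ = 7h`, `R₁ ≤ 10h`: `O(1/h)`.  HONEST FRAMING: a tool for a HYPOTHETICAL filament skeleton on the NEGATIVE side of a MODEL route; nothing here bears
on Navier–Stokes regularity or blow-up.  `--supports stmt-NavierStokesRegularity-23320`.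
-/

set_option linter.dupNamespace false

noncomputable section

namespace Summit.NavierStokesRegularity.NavierStokesRegularity.Theorems.StadiumConnectorBound

open Set Metric MeasureTheory
open scoped InnerProductSpace Matrix
open Summit.NavierStokesRegularity.NavierStokesRegularity.Theorems.StadiumContourPositivityAbs
open Summit.NavierStokesRegularity.NavierStokesRegularity.Theorems.StadiumBaseMargin
open Summit.NavierStokesRegularity.NavierStokesRegularity.Theorems.StadiumMarginKernel
open Summit.NavierStokesRegularity.NavierStokesRegularity.Theorems.StadiumChordCrude
open Summit.NavierStokesRegularity.NavierStokesRegularity.Theorems.StadiumFixedSourcePiece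

/-- **The frozen connector piece is `O(length)`.**  See the module docstring. [folklore] -/
theorem connector_norm_le {hs L cc M Rb n m r₀ δ κ Λ a b x₀ : ℝ} {F : ℂ → (Fin 3 → ℂ)} {G : ℂ → ℂ}
    (hF : DifferentiableOn ℂ F {z : ℂ | |z.im| < hs ∧ |z.re - cc| < L + hs})
    (hunit : ∀ w ∈ {z : ℂ | |z.im| < hs ∧ |z.re - cc| < L + hs}, ∑ i, (deriv F w i) ^ 2 = 1)
    (hM : ∀ z ∈ {z : ℂ | |z.im| < hs ∧ |z.re - cc| < L + hs}, ‖deriv F z‖ ≤ M)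
    {X : ℝ → EuclideanSpace ℝ (Fin 3)} (hX : Differentiable ℝ X) (hXu : ∀ τ, ‖deriv X τ‖ = 1)
    (hosc : ∀ τ σ, ‖deriv X τ - deriv X σ‖ ≤ Rb)
    (hFX : ∀ r : ℝ, (r : ℂ) ∈ {z : ℂ | |z.im| < hs ∧ |z.re - cc| < L + hs} →
      F r = fun i => ((⟪X r, EuclideanSpace.single i (1:ℝ)⟫_ℝ : ℝ) : ℂ))
    (hGre : ∀ w ∈ {z : ℂ | |z.im| < hs ∧ |z.re - cc| < L + hs}, Λ⁻¹ / 2 ≤ (G w).re)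
    (hn : 1 < n) (hκ : 0 < κ) (hΛ : 0 < Λ) (hab : a ≤ b) {z₀ : ℂ}
    -- the connector `x₀ + it`, `t ∈ [a,b]`: inside `S` with `n`-fold discs
    (hcoS : ∀ t ∈ Icc a b, ((x₀ : ℂ) + (t : ℂ) * Complex.I) ∈ {z : ℂ | |z.im| < hs ∧ |z.re - cc| < L + hs})
    (hcofit : ∀ t ∈ Icc a b, n * |t| < hs ∧ |x₀ - cc| + n * |t| < L + hs)
    -- the targets
    (hballS : ball z₀ δ ⊆ {z : ℂ | |z.im| < hs ∧ |z.re - cc| < L + hs})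
    (hballfit : ∀ z ∈ ball z₀ δ, n * |z.im| < hs ∧ |z.re - cc| + n * |z.im| < L + hs)
    -- geometry: horizontal distance ≥ r₀, height differences ≤ m r₀
    (hm0 : 0 ≤ m) (hm1 : m ≤ 1) (hr₀ : 0 < r₀) (hfarz : ∀ z ∈ ball z₀ δ, r₀ ≤ |z.re - x₀|)
    (hheights : ∀ z ∈ ball z₀ δ, ∀ t ∈ Icc a b, |z.im - t| ≤ m * r₀)
    (hA : 0 ≤ 1 - (Rb + 2 * (√3 * (2 * M * (Real.log (n / (n - 1)) - 1 / n)))) ^ 2 / 2)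
    (hC : 0 < (1 - m ^ 2) * (1 - (Rb + 2 * (√3 * (2 * M * (Real.log (n / (n - 1)) - 1 / n)))) ^ 2 / 2) -
      2 * m * (2 * (√3 * (M * Real.log (n / (n - 1)))) * (Rb + 2 * (√3 * (2 * M * (Real.log (n / (n - 1)) - 1 / n)))))) :
    ∀ z ∈ ball z₀ δ, ‖∫ t in Icc a b,
      (((∑ i, (F z i - F ((x₀ : ℂ) + (((max a (min t b) : ℝ)) : ℂ) * Complex.I) i) ^ 2) +
          (κ : ℂ) * G ((x₀ : ℂ) + (((max a (min t b) : ℝ)) : ℂ) * Complex.I)) ^ ((3:ℂ) / 2))⁻¹ •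
        (deriv F ((x₀ : ℂ) + (((max a (min t b) : ℝ)) : ℂ) * Complex.I) ⨯₃
          (fun i => F z i - F ((x₀ : ℂ) + (((max a (min t b) : ℝ)) : ℂ) * Complex.I) i))‖ ≤
      (b - a) * ((r₀ ^ 2 * ((1 - m ^ 2) * (1 - (Rb + 2 * (√3 * (2 * M * (Real.log (n / (n - 1)) - 1 / n)))) ^ 2 / 2) -
        2 * m * (2 * (√3 * (M * Real.log (n / (n - 1)))) * (Rb + 2 * (√3 * (2 * M * (Real.log (n / (n - 1)) - 1 / n))))))) ^ (-(3/2 : ℝ)) *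
        (2 * M ^ 2 * (δ + |z₀.re - x₀| + (|z₀.im - a| + |z₀.im - b|)))) := by
  set S : Set ℂ := {z : ℂ | |z.im| < hs ∧ |z.re - cc| < L + hs} with hS
  have hSo : IsOpen S := by
    have h1 : IsOpen {z : ℂ | |z.im| < hs} := isOpen_lt (continuous_abs.comp Complex.continuous_im) continuous_const
    have h2 : IsOpen {z : ℂ | |z.re - cc| < L + hs} :=
      isOpen_lt (continuous_abs.comp (Complex.continuous_re.sub continuous_const)) continuous_const
    exact h1.inter h2
  set cl : ℝ → ℝ := fun t => max a (min t b) with hcl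
  have hcl_mem : ∀ t, cl t ∈ Icc a b := fun t => ⟨le_max_left _ _, max_le hab (min_le_right _ _)⟩
  set ζf : ℝ → ℂ := fun t => (x₀ : ℂ) + ((cl t : ℝ) : ℂ) * Complex.I with hζf
  have hζS : ∀ t, ζf t ∈ S := fun t => hcoS _ (hcl_mem t)
  have hζim : ∀ t, (ζf t).im = cl t := fun t => by simp [hζf]
  have hζre : ∀ t, (ζf t).re = x₀ := fun t => by simp [hζf]
  -- continuity of the clamped data
  -- the margin from sloped pairs
  set C : ℝ := (1 - m ^ 2) * (1 - (Rb + 2 * (√3 * (2 * M * (Real.log (n / (n - 1)) - 1 / n)))) ^ 2 / 2) -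
      2 * m * (2 * (√3 * (M * Real.log (n / (n - 1)))) * (Rb + 2 * (√3 * (2 * M * (Real.log (n / (n - 1)) - 1 / n))))) with hCdef
  set m₀ : ℝ := r₀ ^ 2 * C with hm₀def
  have hm₀pos : 0 < m₀ := by positivity
  have hmargin : ∀ z ∈ ball z₀ δ, ∀ t : ℝ, m₀ ≤ ((∑ i, (F z i - F (ζf t) i) ^ 2) + (κ : ℂ) * G (ζf t)).re := by
    intro z hz t
    obtain ⟨hzfit, hzfit'⟩ := hballfit z hz
    obtain ⟨hζfit, hζfit'⟩ := hcofit _ (hcl_mem t)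
    have hζfit1 : n * |(ζf t).im| < hs := by rw [hζim]; exact hζfit
    have hζfit1' : |(ζf t).re - cc| + n * |(ζf t).im| < L + hs := by rw [hζim, hζre]; exact hζfit'
    have hre : r₀ ≤ |z.re - (ζf t).re| := by rw [hζre]; exact hfarz z hz
    have hslope : |z.im - (ζf t).im| ≤ m * |z.re - (ζf t).re| := by
      rw [hζim]
      exact (hheights z hz _ (hcl_mem t)).trans (mul_le_mul_of_nonneg_left (by rw [hζre]; exact hfarz z hz) hm0)
    have h := pair_base_re_ge_slope_abs hF hunit hM hX hXu hosc hFX hn hzfit hzfit' hζfit1 hζfit1' hm0 hm1 hslope hA hκ.le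
      (hGre _ (hζS t))
    rw [← hCdef] at h
    have h1 : r₀ ^ 2 * C ≤ (z.re - (ζf t).re) ^ 2 * C := by
      have : r₀ ^ 2 ≤ (z.re - (ζf t).re) ^ 2 := by
        have := pow_le_pow_left₀ hr₀.le hre 2; rwa [sq_abs] at this
      exact mul_le_mul_of_nonneg_right this hC.le
    have h2 : 0 ≤ κ * (Λ⁻¹ / 2) := by positivity
    rw [hm₀def]; linarith
  have hpos : ∀ z ∈ ball z₀ δ, ∀ t ∈ Icc a b, 0 < ((∑ i, (F z i - F (ζf t) i) ^ 2) + (κ : ℂ) * G (ζf t)).re :=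
    fun z hz t _ => lt_of_lt_of_le hm₀pos (hmargin z hz t)
  -- the dominating constant
  set R₁ : ℝ := δ + |z₀.re - x₀| + (|z₀.im - a| + |z₀.im - b|) with hR₁
  have hdist : ∀ z ∈ ball z₀ δ, ∀ t : ℝ, ‖z - ζf t‖ ≤ R₁ := by
    intro z hz t
    have hzz : ‖z - z₀‖ < δ := by rwa [mem_ball, dist_eq_norm] at hz
    have h1 : ‖z₀ - ζf t‖ ≤ |z₀.re - x₀| + |z₀.im - cl t| := by
      have h := Complex.norm_le_abs_re_add_abs_im (z₀ - ζf t)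
      rw [Complex.sub_re, Complex.sub_im, hζre, hζim] at h
      exact h
    have h3 : |z₀.im - cl t| ≤ |z₀.im - a| + |z₀.im - b| := by
      have hm := hcl_mem t
      rcases le_total (z₀.im) (cl t) with h | h
      · rw [abs_of_nonpos (by linarith)]
        have : |z₀.im - b| ≥ -(z₀.im - b) := neg_le_abs _
        linarith [hm.2, abs_nonneg (z₀.im - a)]
      · rw [abs_of_nonneg (by linarith)]
        have : |z₀.im - a| ≥ z₀.im - a := le_abs_self _
        linarith [hm.1, abs_nonneg (z₀.im - b)]
    calc ‖z - ζf t‖ ≤ ‖z - z₀‖ + ‖z₀ - ζf t‖ := norm_sub_le_norm_sub_add_norm_sub _ _ _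
      _ ≤ R₁ := by rw [hR₁]; linarith
  have hdom : ∀ z ∈ ball z₀ δ, ∀ t ∈ Icc a b,
      ‖(((∑ i, (F z i - F (ζf t) i) ^ 2) + (κ : ℂ) * G (ζf t)) ^ ((3:ℂ) / 2))⁻¹ •
        (deriv F (ζf t) ⨯₃ (fun i => F z i - F (ζf t) i))‖ ≤ m₀ ^ (-(3/2 : ℝ)) * (2 * M ^ 2 * R₁) := by
    intro z hz t _
    have hzS : z ∈ S := hballS hz
    have hseg : segment ℝ (ζf t) z ⊆ S := (stadium_convex hs L cc).segment_subset (hζS t) hzS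
    have hdiff : ∀ u ∈ segment ℝ (ζf t) z, DifferentiableAt ℂ F u := fun u hu => hF.differentiableAt (hSo.mem_nhds (hseg hu))
    have hMseg : ∀ u ∈ segment ℝ (ζf t) z, ‖deriv F u‖ ≤ M := fun u hu => hM u (hseg hu)
    have hfun : (fun i => F z i - F (ζf t) i) = F z - F (ζf t) := by funext i; simp [Pi.sub_apply]
    rw [hfun]
    exact kernel_norm_le_of_margin_chord hm₀pos (hmargin z hz t) (hM _ (hζS t)) hdiff hMseg (hdist z hz t)
  intro z hz
  have h := norm_setIntegral_le_of_norm_le_const (μ := volume) (s := Icc a b) (by rw [Real.volume_Icc]; exact ENNReal.ofReal_lt_top)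
    (fun t ht => hdom z hz t ht)
  rw [Real.volume_real_Icc_of_le hab] at h
  change ‖∫ t in Icc a b, (((∑ i, (F z i - F (ζf t) i) ^ 2) + (κ : ℂ) * G (ζf t)) ^ ((3:ℂ) / 2))⁻¹ •
      (deriv F (ζf t) ⨯₃ (fun i => F z i - F (ζf t) i))‖ ≤ (b - a) * (m₀ ^ (-(3/2 : ℝ)) * (2 * M ^ 2 * R₁))
  calc _ ≤ m₀ ^ (-(3/2 : ℝ)) * (2 * M ^ 2 * R₁) * (b - a) := h
    _ = (b - a) * (m₀ ^ (-(3/2 : ℝ)) * (2 * M ^ 2 * R₁)) := by ring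

end Summit.NavierStokesRegularity.NavierStokesRegularity.Theorems.StadiumConnectorBound

end
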